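import Summits.ABC.ABC.Theses.PlaceCountSzpiro
import Summits.ABC.Harvest.OpenQuestions
import Literature.NumberTheory.DiophantineGeometry.AbcWave0BakerExplicitProofs
import HarnessLib

/-!
# Route PlaceCountSzpiro — item `PlaceBudgetPayoff` (stmt-ABC-25423): the budget payoff X1 ⟹ A1′

`Summit.ABC.ABC.Theses.PlaceCountSzpiro.PlaceBudgetPayoff := PlaceBudgetSzpiro →
Summit.ABC.Harvest.SubexponentialSzpiro`.

`PlaceBudgetSzpiro` (crux X1 of the line, stmt-ABC-25422, OPEN, 0 seats) says that there are real
`c ≥ 1`, `K ≥ 0`, `B ≥ 0` with `log |Δ_min(E)| ≤ c ^ ω(N_E) · (K · log N_E + B)` for every elliptic curve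
`E/ℚ`, `ω(N_E) = #(N_E).primeFactors` — Szpiro's inequality with a linear `log N` and a simply-exponential
budget in the place count. `SubexponentialSzpiro` (harvested rung A1′, Pasten, JNT 254 (2024) §1; cell
abc-harv, `OpenQuestions.lean` §1) is `∀ ε > 0, ∃ C, ∀ E/ℚ, log |Δ_min(E)| ≤ C · N_E ^ ε`.

Proof of the payoff (elementary; every input is PROVED in the tree or in Mathlib, no named-fact
hypothesis):

* `ω(N)! ≤ ∏_{p ∣ N} p ≤ N` (`Literature.NumberTheory.DiophantineGeometry.card_factorial_le_prod`,
  `Nat.prod_primeFactors_dvd`);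
* one term of the exponential series (Mathlib `Real.pow_div_factorial_le_exp` at `x = c^{1/δ}`):
  `k · log c ≤ δ · c^{1/δ} + δ · log k!`, hence `c ^ ω(N) ≤ e^{δ c^{1/δ}} · N ^ δ` for every `δ > 0`;
* `log N ≤ N^δ / δ` (`Real.log_le_rpow_div`) and `1 ≤ N^δ` give `K log N + B ≤ (K/δ + B) · N^δ`;
* at `δ = ε/2`: `log |Δ_min| ≤ e^{(ε/2) c^{2/ε}} · (2K/ε + B) · N_E ^ ε`.

Main declarations (namespace `Summit.ABC.ABC.Theorems`):

* `PlaceCountSzpiroPayoff.pow_le_exp_mul_rpow` — `c ^ k ≤ e^{δ c^{1/δ}} · y ^ δ` whenever `k! ≤ y`;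
* `PlaceCountSzpiroPayoff.factorial_card_primeFactors_le` — `ω(n)! ≤ n` for `n ≠ 0`;
* `PlaceCountSzpiroPayoff.pow_card_primeFactors_le` — `c ^ ω(n) ≤ e^{δ c^{1/δ}} · n ^ δ`;
* `subexponentialSzpiro_of_placeBudgetSzpiro : PlaceBudgetSzpiro → Summit.ABC.Harvest.SubexponentialSzpiro`;
* `placeBudgetPayoff_proof : Summit.ABC.ABC.Theses.PlaceCountSzpiro.PlaceBudgetPayoff` (closes stmt-ABC-25423).

HONESTY (D-0139/D-0140). This is the certified elementary content of the line (the twin of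
`placewisePayoff_proof` with `ω(N)! ≤ N` in place of `2 ^ ω(N) ≤ N`), NOT progress on the crux
`PlaceBudgetSzpiro` (OPEN, 0 seats); `SubexponentialSzpiro` (rung «A1′ — NOT abc — SUBEXP-SZPIRO»,
proposed) and A-PS («NOT abc — POLY-SZPIRO(E)») are NOT abc; abc is not proved by any of this; abc
distance 0; typed ≠ proved. No `sorry`, no new axiom, no `def`.
-/

noncomputable section

-- `Summit.<Summit>.<Problem>` is the mandated summit-side namespace (CONVENTIONS §2); for the
-- single-conjunct summit `ABC` the two coincide, so the duplicate `ABC.ABC` is deliberate.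
set_option linter.dupNamespace false

namespace Summit.ABC.ABC.Theorems

open Finset
open scoped Nat
open Summit.ABC.ABC.Theses.PlaceCountSzpiro
open Literature.NumberTheory.DiophantineGeometry (card_factorial_le_prod)

namespace PlaceCountSzpiroPayoff

/-! ### Elementary real-analysis bookkeeping -/

/-- **One term of the exponential series, in budget form.** For `c ≥ 1`, `δ > 0`, every `k : ℕ` and
every real `y ≥ k!`: `c ^ k ≤ exp (δ · c^{1/δ}) · y ^ δ`. Indeed with `x = c^{1/δ} ≥ 1`,
`x^k / k! ≤ e^x` (Mathlib `Real.pow_div_factorial_le_exp`) reads `(k/δ)·log c ≤ x + log k! ≤ x + log y`;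
multiply by `δ` and exponentiate. [folklore] -/
theorem pow_le_exp_mul_rpow {c δ : ℝ} (hc : 1 ≤ c) (hδ : 0 < δ) (k : ℕ) {y : ℝ}
    (hy : ((k ! : ℕ) : ℝ) ≤ y) : c ^ k ≤ Real.exp (δ * c ^ (1 / δ)) * y ^ δ := by
  have hc0 : 0 < c := by linarith
  have hfac0 : (0 : ℝ) < ((k ! : ℕ) : ℝ) := by exact_mod_cast Nat.factorial_pos k
  have hy0 : 0 < y := lt_of_lt_of_le hfac0 hy
  set x : ℝ := c ^ (1 / δ) with hx_def
  have hx1 : 1 ≤ x := Real.one_le_rpow hc (by positivity)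
  have hx0 : 0 < x := by linarith
  -- the exponential-series term
  have hser : x ^ k / ((k ! : ℕ) : ℝ) ≤ Real.exp x := Real.pow_div_factorial_le_exp x hx0.le k
  have hlog : (k : ℝ) * Real.log x - Real.log ((k ! : ℕ) : ℝ) ≤ x := by
    have h := Real.log_le_log (by positivity) hser
    rwa [Real.log_exp, Real.log_div (by positivity) hfac0.ne', Real.log_pow] at h
  have hlogx : Real.log x = (1 / δ) * Real.log c := by
    rw [hx_def, Real.log_rpow hc0]
  have hlogy : Real.log ((k ! : ℕ) : ℝ) ≤ Real.log y := Real.log_le_log hfac0 hy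
  -- `k · log c ≤ δ x + δ log y`
  have hmain : (k : ℝ) * Real.log c ≤ δ * x + δ * Real.log y := by
    have h1 : (k : ℝ) * ((1 / δ) * Real.log c) ≤ x + Real.log y := by
      rw [← hlogx]; linarith
    have h2 : δ * ((k : ℝ) * ((1 / δ) * Real.log c)) ≤ δ * (x + Real.log y) :=
      mul_le_mul_of_nonneg_left h1 hδ.le
    have h3 : δ * ((k : ℝ) * ((1 / δ) * Real.log c)) = (k : ℝ) * Real.log c := by
      field_simp
    linarith [h2, h3]
  -- exponentiate
  have hck : c ^ k = Real.exp ((k : ℝ) * Real.log c) := by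
    rw [← Real.log_pow, Real.exp_log (pow_pos hc0 k)]
  have hyδ : y ^ δ = Real.exp (δ * Real.log y) := by
    rw [Real.rpow_def_of_pos hy0, mul_comm]
  rw [hck, hyδ, ← Real.exp_add]
  exact Real.exp_le_exp.mpr hmain

/-- `ω(n)! ≤ n` for `n ≠ 0`: the `ω(n)` distinct primes of `n` are `ω(n)` distinct positive integers,
so their product `∏_{p ∣ n} p` is at least `ω(n)!` (`card_factorial_le_prod`), and it divides `n`
(`Nat.prod_primeFactors_dvd`). [folklore] -/
theorem factorial_card_primeFactors_le {n : ℕ} (hn : n ≠ 0) : (n.primeFactors.card)! ≤ n :=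
  calc (n.primeFactors.card)! ≤ ∏ p ∈ n.primeFactors, p :=
        card_factorial_le_prod _ fun _ hp => (Nat.prime_of_mem_primeFactors hp).one_le
    _ ≤ n := Nat.le_of_dvd (Nat.pos_of_ne_zero hn) (Nat.prod_primeFactors_dvd n)

/-- **The place budget is sub-polynomial.** For `c ≥ 1` and `δ > 0`:
`c ^ ω(n) ≤ exp (δ · c^{1/δ}) · n ^ δ` for every `n ≠ 0` (`ω(n) = #n.primeFactors`), from `ω(n)! ≤ n`
and `pow_le_exp_mul_rpow`. [folklore] -/
theorem pow_card_primeFactors_le {c δ : ℝ} (hc : 1 ≤ c) (hδ : 0 < δ) {n : ℕ} (hn : n ≠ 0) :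
    c ^ n.primeFactors.card ≤ Real.exp (δ * c ^ (1 / δ)) * (n : ℝ) ^ δ :=
  pow_le_exp_mul_rpow hc hδ _ (by exact_mod_cast factorial_card_primeFactors_le hn)

/-- `K · log N + B ≤ (K / δ + B) · N ^ δ` for `N ≥ 1`, `K, B ≥ 0`, `δ > 0`
(`log N ≤ N^δ/δ`, `1 ≤ N^δ`). [folklore] -/
theorem linear_log_le_rpow {N K B δ : ℝ} (hN : 1 ≤ N) (hK : 0 ≤ K) (hB : 0 ≤ B) (hδ : 0 < δ) :
    K * Real.log N + B ≤ (K / δ + B) * N ^ δ := by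
  have hN0 : 0 ≤ N := by linarith
  have hlog : Real.log N ≤ N ^ δ / δ := Real.log_le_rpow_div hN0 hδ
  have hone : 1 ≤ N ^ δ := Real.one_le_rpow hN hδ.le
  have h1 : K * Real.log N ≤ K / δ * N ^ δ := by
    calc K * Real.log N ≤ K * (N ^ δ / δ) := mul_le_mul_of_nonneg_left hlog hK
      _ = K / δ * N ^ δ := by ring
  have h2 : B ≤ B * N ^ δ := by
    calc B = B * 1 := (mul_one B).symm
      _ ≤ B * N ^ δ := mul_le_mul_of_nonneg_left hone hB
  calc K * Real.log N + B ≤ K / δ * N ^ δ + B * N ^ δ := add_le_add h1 h2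
    _ = (K / δ + B) * N ^ δ := by ring

end PlaceCountSzpiroPayoff

open PlaceCountSzpiroPayoff

/-- **Payoff of the line, named form: `PlaceBudgetSzpiro ⟹ SubexponentialSzpiro`.** If
`log |Δ_min(E)| ≤ c ^ ω(N_E) · (K log N_E + B)` for all `E/ℚ` (`c ≥ 1`, `K, B ≥ 0`), then for every
`ε > 0`, `log |Δ_min(E)| ≤ C(ε) · N_E ^ ε` with `C(ε) = exp ((ε/2) · c^{2/ε}) · (2K/ε + B)`:
`ω(N)! ≤ N` makes the budget `c ^ ω(N)` at most `exp((ε/2) c^{2/ε}) · N^{ε/2}`, and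
`K log N + B ≤ (2K/ε + B) · N^{ε/2}`. `SubexponentialSzpiro` is the harvested rung of Pasten, JNT 254
(2024) §1 («A1′ — NOT abc»); the hypothesis X1 is OPEN. [folklore] -/
theorem subexponentialSzpiro_of_placeBudgetSzpiro (hX : PlaceBudgetSzpiro) :
    Summit.ABC.Harvest.SubexponentialSzpiro := by
  obtain ⟨c, K, B, hc, hK, hB, hW⟩ := hX
  intro ε hε
  have hδ : 0 < ε / 2 := half_pos hε
  refine ⟨Real.exp (ε / 2 * c ^ (1 / (ε / 2))) * (K / (ε / 2) + B), fun W _ => ?_⟩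
  have hNpos : 0 < W.conductorNorm ℤ := WeierstrassCurve.conductorNorm_pos_holds W
  have hN1 : (1 : ℝ) ≤ (W.conductorNorm ℤ : ℝ) := by exact_mod_cast hNpos
  have hN0 : (0 : ℝ) < (W.conductorNorm ℤ : ℝ) := by linarith
  -- the budget is sub-polynomial
  have hbudget : c ^ (W.conductorNorm ℤ).primeFactors.card ≤
      Real.exp (ε / 2 * c ^ (1 / (ε / 2))) * (W.conductorNorm ℤ : ℝ) ^ (ε / 2) :=
    pow_card_primeFactors_le hc hδ hNpos.ne'
  -- the linear factor is sub-polynomial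
  have hlin : K * Real.log (W.conductorNorm ℤ : ℝ) + B ≤
      (K / (ε / 2) + B) * (W.conductorNorm ℤ : ℝ) ^ (ε / 2) :=
    linear_log_le_rpow hN1 hK hB hδ
  have hlin0 : 0 ≤ K * Real.log (W.conductorNorm ℤ : ℝ) + B := by
    have := Real.log_nonneg hN1
    positivity
  have hbudget0 : 0 ≤ Real.exp (ε / 2 * c ^ (1 / (ε / 2))) * (W.conductorNorm ℤ : ℝ) ^ (ε / 2) := by
    positivity
  have hsplit : (W.conductorNorm ℤ : ℝ) ^ (ε / 2) * (W.conductorNorm ℤ : ℝ) ^ (ε / 2) =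
      (W.conductorNorm ℤ : ℝ) ^ ε := by
    rw [← Real.rpow_add hN0]; ring_nf
  calc Real.log (W.minimalDiscriminantNorm ℤ : ℝ)
      ≤ c ^ (W.conductorNorm ℤ).primeFactors.card * (K * Real.log (W.conductorNorm ℤ : ℝ) + B) := hW W
    _ ≤ (Real.exp (ε / 2 * c ^ (1 / (ε / 2))) * (W.conductorNorm ℤ : ℝ) ^ (ε / 2)) *
          ((K / (ε / 2) + B) * (W.conductorNorm ℤ : ℝ) ^ (ε / 2)) :=
        mul_le_mul hbudget hlin hlin0 hbudget0
    _ = Real.exp (ε / 2 * c ^ (1 / (ε / 2))) * (K / (ε / 2) + B) *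
          ((W.conductorNorm ℤ : ℝ) ^ (ε / 2) * (W.conductorNorm ℤ : ℝ) ^ (ε / 2)) := by ring
    _ = Real.exp (ε / 2 * c ^ (1 / (ε / 2))) * (K / (ε / 2) + B) * (W.conductorNorm ℤ : ℝ) ^ ε := by
        rw [hsplit]

/-- **Item stmt-ABC-25423 `PlaceBudgetPayoff` (route PlaceCountSzpiro, crux, rank 3).** The crux X1
`PlaceBudgetSzpiro` implies the sub-exponential Szpiro bound `∀ ε > 0, ∃ C, ∀ E/ℚ, log |Δ_min(E)| ≤ C · N_E^ε`
— the conclusion is verbatim `Summit.ABC.Harvest.SubexponentialSzpiro`, so this is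
`subexponentialSzpiro_of_placeBudgetSzpiro` at the route's spelling. Certified content of the line, not
progress on the crux (X1 OPEN); «A1′ — NOT abc»; A-PS is «NOT abc — POLY-SZPIRO(E)». [folklore] -/
theorem placeBudgetPayoff_proof : Summit.ABC.ABC.Theses.PlaceCountSzpiro.PlaceBudgetPayoff := by
  unfold PlaceBudgetPayoff
  intro hX
  exact subexponentialSzpiro_of_placeBudgetSzpiro hX

end Summit.ABC.ABC.Theorems

end
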